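import Literature.Topology.FourManifolds.BasinConeMap

/-!
# The cone parametrisation of the basin by the model vector space

Topic `Literature/Topology/FourManifolds` (support of `stmt-SmoothPoincare4-15190`; sequel of
`BasinSpherical.lean`, used for the orientation law of the entrance sheets).  Everything here is
**proved**.

For a basin setting `B` of `(g, ξ)` the spherical coordinates `(dir x, g x)` of
`BasinSpherical.lean` are repackaged as **one parametrisation by the punctured model space**:

* `BasinSetting.coneParam B w = conePt ((rad / ‖w‖) • w) (g p₀ + ‖w‖)` — the basin point of
  direction `w / ‖w‖` and level `g p₀ + ‖w‖`;
* `BasinSetting.coneInv B x = ((g x - g p₀) / rad) • dir x` — its left inverse;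

`coneInv (coneParam w) = w` on the open set `coneDom` (rays meeting the level), and
`coneParam (coneInv x) = x` at the basin points other than `p₀` below `hi`; `coneParam` is smooth
on `coneDom`, `coneInv` at those basin points.  So `coneParam` is a parametrisation of the
punctured basin with a smooth left inverse — a chart-like datum on a manifold with boundary, to
which the frame-character bookkeeping of `FrameCharacterParam.lean` applies; the spherical shells
`{r₁ < ‖w‖ < r₂}` below the first saddle value are preconnected parts of its domain
(`isPreconnected_shell`).

## References

* J. Milnor, *Lectures on the h-cobordism theorem* (1965), Def. 3.9, Thm. 3.4 (PDF pp. 12–16).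
  [MilnorHCobordism1965]
-/

open scoped Manifold ContDiff Topology
open Set Function Filter Metric

noncomputable section

namespace Literature.Topology.FourManifolds

open Cobordism FourManifolds.Flow

universe u

/-! ### Spherical shells are preconnected -/

/-- **A spherical shell `{r₁ < ‖w‖ < r₂}` of a real normed space of dimension `> 1` is
preconnected**: it is the image of the connected `sphere × (r₁, r₂)` under `(u, t) ↦ t • u`. [folklore] -/
theorem isPreconnected_shell {F : Type*} [NormedAddCommGroup F] [NormedSpace ℝ F] (hF : 1 < Module.rank ℝ F)
    {r₁ r₂ : ℝ} (hr₁ : 0 ≤ r₁) : IsPreconnected {w : F | r₁ < ‖w‖ ∧ ‖w‖ < r₂} := by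
  rcases lt_or_ge r₁ r₂ with hlt | hge
  · have hS : IsConnected (Metric.sphere (0 : F) 1) := isConnected_sphere hF 0 zero_le_one
    have hI : IsConnected (Ioo r₁ r₂) := isConnected_Ioo hlt
    have hprod : IsConnected (Metric.sphere (0 : F) 1 ×ˢ Ioo r₁ r₂) := hS.prod hI
    have himage : (fun p : F × ℝ => p.2 • p.1) '' (Metric.sphere (0 : F) 1 ×ˢ Ioo r₁ r₂) = {w : F | r₁ < ‖w‖ ∧ ‖w‖ < r₂} := by
      ext w
      simp only [mem_image, mem_prod, mem_sphere_zero_iff_norm, mem_Ioo, mem_setOf_eq, Prod.exists]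
      constructor
      · rintro ⟨u, t, ⟨hu, ht1, ht2⟩, rfl⟩
        have ht0 : 0 < t := hr₁.trans_lt ht1
        rw [norm_smul, Real.norm_of_nonneg ht0.le, hu, mul_one]
        exact ⟨ht1, ht2⟩
      · rintro ⟨h1, h2⟩
        have hw0 : 0 < ‖w‖ := hr₁.trans_lt h1
        refine ⟨‖w‖⁻¹ • w, ‖w‖, ⟨by rw [norm_smul, norm_inv, norm_norm, inv_mul_cancel₀ hw0.ne'], h1, h2⟩, ?_⟩
        rw [smul_smul, mul_inv_cancel₀ hw0.ne', one_smul]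
    rw [← himage]
    exact (hprod.image _ ((continuous_snd.smul continuous_fst).continuousOn)).isPreconnected
  · have he : {w : F | r₁ < ‖w‖ ∧ ‖w‖ < r₂} = ∅ := by
      ext w; simp only [mem_setOf_eq, mem_empty_iff_false, iff_false, not_and, not_lt]
      intro h; exact hge.trans h.le
    rw [he]; exact isPreconnected_empty

namespace BasinSetting

variable {n : ℕ} {W : Type u} [TopologicalSpace W] [T2Space W] [SecondCountableTopology W]
  [CompactSpace W] [ChartedSpace (EuclideanHalfSpace (n + 1)) W] [IsManifold (𝓡∂ (n + 1)) ∞ W]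
  {g : W → ℝ} {ξ : Π x : W, TangentSpace (𝓡∂ (n + 1)) x} (B : BasinSetting g ξ)

/-! ### The cone parametrisation and its inverse -/

/-- **The cone parametrisation**: the basin point of direction `w / ‖w‖` (scaled to the small
sphere) and level `g p₀ + ‖w‖`. [cite: MilnorHCobordism1965, Def. 3.9, Thm. 3.4] -/
def coneParam (w : EuclideanSpace ℝ (Fin (n + 1))) : W := B.conePt ((B.rad / ‖w‖) • w) (g B.p₀ + ‖w‖)

/-- **The inverse of the cone parametrisation**: `((g x - g p₀) / rad) • dir x`. [cite: MilnorHCobordism1965, Def. 3.9, Thm. 3.4] -/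
def coneInv (x : W) : EuclideanSpace ℝ (Fin (n + 1)) := ((g x - g B.p₀) / B.rad) • B.dir x

/-- **The domain of the cone parametrisation**: non-zero vectors whose level lies below `hi` and is
met by the ray of their direction. [folklore] -/
def coneDom : Set (EuclideanSpace ℝ (Fin (n + 1))) :=
  {w | w ≠ 0 ∧ g B.p₀ + ‖w‖ < B.hi ∧ Hits B.θ g (g B.p₀ + ‖w‖) (B.ofChart ((B.rad / ‖w‖) • w))}

variable {B}

/-- Unfolding `coneParam`. [folklore] -/
theorem coneParam_def (w : EuclideanSpace ℝ (Fin (n + 1))) : B.coneParam w = B.conePt ((B.rad / ‖w‖) • w) (g B.p₀ + ‖w‖) := rfl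

/-- Unfolding `coneInv`. [folklore] -/
theorem coneInv_def (x : W) : B.coneInv x = ((g x - g B.p₀) / B.rad) • B.dir x := rfl

/-- Membership in `coneDom`. [folklore] -/
theorem mem_coneDom_iff {w : EuclideanSpace ℝ (Fin (n + 1))} : w ∈ B.coneDom ↔
    w ≠ 0 ∧ g B.p₀ + ‖w‖ < B.hi ∧ Hits B.θ g (g B.p₀ + ‖w‖) (B.ofChart ((B.rad / ‖w‖) • w)) := Iff.rfl

/-- The scaled vector `(rad / ‖w‖) • w` has norm `rad`. [folklore] -/
theorem norm_rad_div_smul {w : EuclideanSpace ℝ (Fin (n + 1))} (hw : w ≠ 0) : ‖(B.rad / ‖w‖) • w‖ = B.rad := by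
  have hn : 0 < ‖w‖ := norm_pos_iff.2 hw
  rw [norm_smul, Real.norm_of_nonneg (div_pos B.rad_pos hn).le, div_mul_cancel₀ _ hn.ne']

/-- **`coneInv ∘ coneParam = id` on the domain.** [folklore] -/
theorem coneInv_coneParam {w : EuclideanSpace ℝ (Fin (n + 1))} (hw : w ∈ B.coneDom) : B.coneInv (B.coneParam w) = w := by
  obtain ⟨hw0, -, hhit⟩ := hw
  have hn : 0 < ‖w‖ := norm_pos_iff.2 hw0
  rw [coneInv_def, coneParam_def, B.dir_conePt (B.norm_rad_div_smul hw0), B.apply_conePt hhit, add_sub_cancel_left, smul_smul,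
    div_mul_div_cancel₀ B.rad_pos.ne', div_self hn.ne', one_smul]

/-- **`coneParam ∘ coneInv = id` at the basin points other than `p₀` below `hi`.** [folklore] -/
theorem coneParam_coneInv {x : W} (hx : x ∈ B.basin) (hx0 : x ≠ B.p₀) (hxhi : g x < B.hi) : B.coneParam (B.coneInv x) = x := by
  obtain ⟨hn, -, hc⟩ := B.exists_eq_conePt_of_mem_basin hx hx0 hxhi
  have hgx : 0 < g x - g B.p₀ := by linarith [B.apply_p₀_lt hx0]
  have hnw : ‖B.coneInv x‖ = g x - g B.p₀ := by
    rw [coneInv_def, norm_smul, Real.norm_of_nonneg (div_pos hgx B.rad_pos).le, hn, div_mul_cancel₀ _ B.rad_pos.ne']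
  have hdir : (B.rad / ‖B.coneInv x‖) • B.coneInv x = B.dir x := by
    rw [hnw, coneInv_def, smul_smul, div_mul_div_comm, mul_comm, div_self (mul_ne_zero hgx.ne' B.rad_pos.ne'), one_smul]
  rw [coneParam_def, hdir, hnw, add_sub_cancel]
  exact hc

/-- The level of a basin point gives the norm of its cone coordinate. [folklore] -/
theorem norm_coneInv {x : W} (hx : x ∈ B.basin) (hx0 : x ≠ B.p₀) (hxhi : g x < B.hi) : ‖B.coneInv x‖ = g x - g B.p₀ := by
  obtain ⟨hn, -, -⟩ := B.exists_eq_conePt_of_mem_basin hx hx0 hxhi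
  have hgx : 0 < g x - g B.p₀ := by linarith [B.apply_p₀_lt hx0]
  rw [coneInv_def, norm_smul, Real.norm_of_nonneg (div_pos hgx B.rad_pos).le, hn, div_mul_cancel₀ _ B.rad_pos.ne']

/-- **The cone coordinate of a basin point lies in the domain.** [folklore] -/
theorem coneInv_mem_coneDom {x : W} (hx : x ∈ B.basin) (hx0 : x ≠ B.p₀) (hxhi : g x < B.hi) : B.coneInv x ∈ B.coneDom := by
  obtain ⟨hn, hh, -⟩ := B.exists_eq_conePt_of_mem_basin hx hx0 hxhi
  have hgx : 0 < g x - g B.p₀ := by linarith [B.apply_p₀_lt hx0]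
  have hnw := B.norm_coneInv hx hx0 hxhi
  have hdir : (B.rad / ‖B.coneInv x‖) • B.coneInv x = B.dir x := by
    rw [hnw, coneInv_def, smul_smul, div_mul_div_comm, mul_comm, div_self (mul_ne_zero hgx.ne' B.rad_pos.ne'), one_smul]
  refine ⟨fun h => ?_, by rw [hnw]; linarith, ?_⟩
  · rw [h, norm_zero] at hnw; linarith
  · rw [hdir, hnw, add_sub_cancel]; exact hh

/-- **The cone parametrisation lands in the basin, off the minimum, with the prescribed level.** [folklore] -/
theorem coneParam_mem_basin {w : EuclideanSpace ℝ (Fin (n + 1))} (hw : w ∈ B.coneDom) :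
    B.coneParam w ∈ B.basin ∧ B.coneParam w ≠ B.p₀ ∧ g (B.coneParam w) = g B.p₀ + ‖w‖ := by
  obtain ⟨hw0, hhi, hhit⟩ := hw
  have hn : 0 < ‖w‖ := norm_pos_iff.2 hw0
  refine ⟨B.conePt_mem_basin (B.norm_rad_div_smul hw0) hhi.le hhit, B.conePt_ne_p₀ (by linarith) hhit, B.apply_conePt hhit⟩

/-! ### Openness and smoothness -/

/-- **The domain is open.** [folklore] -/
theorem isOpen_coneDom : IsOpen B.coneDom := by
  rw [isOpen_iff_mem_nhds]
  rintro w ⟨hw0, hhi, hhit⟩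
  have hn : 0 < ‖w‖ := norm_pos_iff.2 hw0
  have hsc : ContinuousAt (fun w : EuclideanSpace ℝ (Fin (n + 1)) => (B.rad / ‖w‖) • w) w :=
    ((continuousAt_const.div continuous_norm.continuousAt hn.ne').smul continuousAt_id)
  have hv : ‖(B.rad / ‖w‖) • w‖ = B.rad := B.norm_rad_div_smul hw0
  have hvr : ‖(B.rad / ‖w‖) • w‖ < B.r₀ := B.norm_lt_r₀_of_eq_rad hv
  have hoc : ContinuousAt (fun w : EuclideanSpace ℝ (Fin (n + 1)) => B.ofChart ((B.rad / ‖w‖) • w)) w :=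
    ContinuousAt.comp (f := fun w : EuclideanSpace ℝ (Fin (n + 1)) => (B.rad / ‖w‖) • w) (g := B.ofChart)
      (BasinSetting.contMDiffAt_ofChart hvr).continuousAt hsc
  -- joint continuity of `(point, level) ↦ Hits` via the openness of `Hits` in the product
  have hℓ : g B.p₀ + ‖w‖ ∈ Ioo B.lo B.hi := B.Ioo_subset_Ioo_lo ⟨by linarith, hhi⟩
  have hslab : g (B.ofChart ((B.rad / ‖w‖) • w)) ∈ Icc B.lo B.hi := by
    rw [(B.apply_ofChart_eq_sphR_iff hvr.le).2 hv]; exact Ioo_subset_Icc_self B.sphR_mem_Ioo_lo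
  have hnc := B.not_isMCriticalPt_ofChart hv
  have hprod := B.slabFlow'.hits_mem_nhds_prod hslab hnc hℓ hhit
  have hpair : ContinuousAt (fun w : EuclideanSpace ℝ (Fin (n + 1)) => (B.ofChart ((B.rad / ‖w‖) • w), g B.p₀ + ‖w‖)) w :=
    hoc.prodMk (continuousAt_const.add continuous_norm.continuousAt)
  have h3 : {v : EuclideanSpace ℝ (Fin (n + 1)) | Hits B.θ g (g B.p₀ + ‖v‖) (B.ofChart ((B.rad / ‖v‖) • v))} ∈ 𝓝 w :=
    hpair.preimage_mem_nhds hprod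
  have h1 : {v : EuclideanSpace ℝ (Fin (n + 1)) | v ≠ 0} ∈ 𝓝 w := isOpen_ne.mem_nhds hw0
  have h2 : {v : EuclideanSpace ℝ (Fin (n + 1)) | g B.p₀ + ‖v‖ < B.hi} ∈ 𝓝 w :=
    (isOpen_lt (continuous_const.add continuous_norm) continuous_const).mem_nhds hhi
  filter_upwards [h1, h2, h3] with v hv1 hv2 hv3
  exact ⟨hv1, hv2, hv3⟩

/-- **The cone parametrisation is smooth on its domain.** [cite: MilnorHCobordism1965, Thm. 4.1 (PDF p. 22)] -/
theorem contMDiffAt_coneParam {w : EuclideanSpace ℝ (Fin (n + 1))} (hw : w ∈ B.coneDom) :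
    ContMDiffAt 𝓘(ℝ, EuclideanSpace ℝ (Fin (n + 1))) (𝓡∂ (n + 1)) ∞ B.coneParam w := by
  obtain ⟨hw0, hhi, hhit⟩ := hw
  have hn : 0 < ‖w‖ := norm_pos_iff.2 hw0
  have hv : ‖(B.rad / ‖w‖) • w‖ = B.rad := B.norm_rad_div_smul hw0
  have h1 : ContDiffAt ℝ ∞ (fun w : EuclideanSpace ℝ (Fin (n + 1)) => (B.rad / ‖w‖) • w) w :=
    (contDiffAt_const.div (contDiffAt_norm ℝ hw0) hn.ne').smul contDiffAt_id
  have h2 : ContDiffAt ℝ ∞ (fun w : EuclideanSpace ℝ (Fin (n + 1)) => g B.p₀ + ‖w‖) w := contDiffAt_const.add (contDiffAt_norm ℝ hw0)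
  have h3 : ContMDiffAt 𝓘(ℝ, EuclideanSpace ℝ (Fin (n + 1))) (𝓘(ℝ, EuclideanSpace ℝ (Fin (n + 1))).prod 𝓘(ℝ, ℝ)) ∞
      (fun w : EuclideanSpace ℝ (Fin (n + 1)) => ((B.rad / ‖w‖) • w, g B.p₀ + ‖w‖)) w :=
    h1.contMDiffAt.prodMk h2.contMDiffAt
  have h4 := (B.contMDiffAt_conePt_prod (by rw [← norm_pos_iff, hv]; exact B.rad_pos) (B.norm_lt_r₀_of_eq_rad hv)
    (B.Ioo_subset_Ioo_lo ⟨by linarith, hhi⟩) hhit).comp w h3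
  exact h4

/-- **The cone parametrisation is smooth on its (open) domain**, as an `On` statement. [folklore] -/
theorem contMDiffOn_coneParam : ContMDiffOn 𝓘(ℝ, EuclideanSpace ℝ (Fin (n + 1))) (𝓡∂ (n + 1)) ∞ B.coneParam B.coneDom :=
  fun _ hw => (contMDiffAt_coneParam hw).contMDiffWithinAt

/-- **The inverse is smooth at the basin points other than `p₀` below `hi`.** [cite: MilnorHCobordism1965, Thm. 4.1 (PDF p. 22)] -/
theorem contMDiffAt_coneInv {x : W} (hx : x ∈ B.basin) (hx0 : x ≠ B.p₀) (hxhi : g x < B.hi) :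
    ContMDiffAt (𝓡∂ (n + 1)) 𝓘(ℝ, EuclideanSpace ℝ (Fin (n + 1))) ∞ B.coneInv x := by
  have hdir := B.contMDiffAt_dir (B.apply_mem_slab hxhi) (B.not_isMCriticalPt_of_mem_basin hx hx0 hxhi.le)
    (B.hits_sphR_of_mem_basin hx hx0 hxhi.le)
  have hg : ContMDiffAt (𝓡∂ (n + 1)) 𝓘(ℝ, ℝ) ∞ (fun x => (g x - g B.p₀) / B.rad) x :=
    ((B.isMorseFunction.isMorse.contMDiff x).sub contMDiffAt_const).div_const _
  exact hg.smul hdir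

/-- **Near a basin point other than `p₀` below `hi`, `coneParam ∘ coneInv` is the identity.** [folklore] -/
theorem coneParam_coneInv_eventuallyEq {x : W} (hx : x ∈ B.basin) (hx0 : x ≠ B.p₀) (hxhi : g x < B.hi) :
    (B.coneParam ∘ B.coneInv) =ᶠ[𝓝 x] id := by
  have hgc : Continuous g := B.isMorseFunction.isMorse.contMDiff.continuous
  filter_upwards [B.isOpen_basin.mem_nhds hx, isOpen_ne.mem_nhds hx0, (isOpen_lt hgc continuous_const).mem_nhds hxhi]
    with y hy hy0 hyhi
  exact B.coneParam_coneInv hy hy0 hyhi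

/-- **Near a point of the domain, `coneInv ∘ coneParam` is the identity.** [folklore] -/
theorem coneInv_coneParam_eventuallyEq {w : EuclideanSpace ℝ (Fin (n + 1))} (hw : w ∈ B.coneDom) :
    (B.coneInv ∘ B.coneParam) =ᶠ[𝓝 w] id := by
  filter_upwards [B.isOpen_coneDom.mem_nhds hw] with v hv
  exact B.coneInv_coneParam hv

end BasinSetting

end Literature.Topology.FourManifolds
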